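import Summits.QuantumFields.YangMills.Theorems.FluctuationComparisonRegPrIntLOrganTangentJensenGapKnit
import Summits.QuantumFields.YangMills.Theorems.FluctuationComparisonRegPrIntLOrganTangentAPackageDescendTo
import HarnessLib

/-!
# Crux `FluctuationComparisonRegPrIntL` (stmt-QuantumFields-20520, rung R3), PATH-B v18 organ O1ᵘ-H v2 (`Cruxes/…/V18DraftTexts.lean` v0.3), LEAD w3 g25
# BRICK 1 «TaylorCutH» (O1ᵘ-H v2 ⟸ LINᵘ-H ∧ JENᵘ-H) — THE m-STEP JENSEN KNIT: the m-step Jensen gap `q = h_j − mfun` IS `∫₀¹ (1−t)·Var_{V,t}(h_K) dt`,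
# the variance of the SEED discrepancy under the interpolated m-step small-field fibre laws (the single-step knit ✓`…OrganTangentJensenGapKnit`
# of w3 g23 transposed from `descend F ℰp j` to `descendTo F ℰp j K`)

Cell `ym3-torus` (rung R3 = continuum `SU(2)` Yang–Mills on T³ — NOT d = 4, NOT infinite volume, NOT a mass gap, NOT Clay), width copy `ym3-torus-px5` (gen 19),
`--kind proof --supports stmt-QuantumFields-20520 --as helper`, count-neutral, definition-free, default heartbeats; THEOREMS ONLY; nothing printed is asserted.

THE CUT.  In O1ᵘ-H v2's frame BELOW THE SEED (`j + 1 ≤ K = Ts`): both towers are SF-projected at every step of `[j, K)`, so by ✓(L18) `towerCut_iterate`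
`ρ_j·dU_j = (descendTo j K)_* (χ_{j,K}·ρ_K·dU_K)`, `ρ′_j·dU_j = (descendTo j K)_* (χ_{j,K}·ρ′_K·dU_K)` with the multi-level-window weight `χ_{j,K}` (✓(L19)).  With the
m-step (A)-package of `descendTo j K` on `MW_{j,K}` (✓(L16), a THEOREM from a height) the kernel proves, POINTWISE on the coarse window `W = {PlaqSmall θ_j}`:
`log ρ_j − log ρ′_j = log ∫ χρ_K dλ_V − log ∫ χρ′_K dλ_V`; the window-continuous localised m-step fibre mean of JENᵘ-H's hypothesis IS
`mfun(V) = (∫ χ h_K ρ′_K dλ_V)∕(∫ χ ρ′_K dλ_V)`, `h_K = log ρ_K − log ρ′_K`; hence with `P_V := (χρ′_K)·λ_V` and `f_V := cgf h_K P_V` (Mathlib):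
★★`jensenGapMW_eq_integral_variance`: `q(V) := log ρ_j V − log ρ′_j V − mfun V = ∫₀¹ (1 − t)·Var[h_K; P_V.tilted (t·h_K)] dt`.
So JENᵘ-H's `HClauseSq` conclusion for `q` follows from the SAME clause for `V ↦ Var[h_K; P_V.tilted (t·h_K)]`, `t`-uniformly, with the letters doubled
(✓`…JensenGapTools.abs_fourPoint_le_of_eq_integral`) — «JENᵘ-H ⟸ JVARᵘ-H»: the Jensen∕log-Laplace language leaves the m-step cone; what remains is a
second-order statement about variances of the m-step small-field fibre laws ([Balaban1987RG1] §2; [Balaban1985UV3] (41)–(47)).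

HONEST FRAMING: a knit over hypothesis letters + [folklore] calculus∕measure theory, all credit for the argument to w3 g23's single-step knit; nothing of
Bałaban's analysis is asserted or proved; JVARᵘ-H, JENᵘ-H, LINᵘ-H, O1ᵘ-H v2, S1aᴴ, crux 20520, `YM3TorusSU2` are NOT proved; the registry
`Lines/semiclassical_s2beta.lean` v11.4 (★★OWNER RULING №36) and `Lines/runpair_organ.lean` are untouched and nothing here is registered; rung R3 = SU(2) YM₃
on T³ — NOT d = 4, NOT infinite volume, NOT a mass gap, NOT Clay; the Yang–Mills mass gap is NOT proved by any of this.
-/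

set_option autoImplicit false

noncomputable section

namespace Summit.QuantumFields.YangMills.Theorems.FluctuationComparisonRegPrIntLOrganTangentJensenGapKnitMW

open MeasureTheory ProbabilityTheory Filter Topology Set
open scoped ENNReal
open Literature.MathematicalPhysics.QuantumFieldTheory.Balaban1983to89
open T3ContinuumYM3Torus T3NestedUnitLaws T3UnitLawDensityEML T3UnitScaleTilt
open Literature.MathematicalPhysics.QuantumFieldTheory.Balaban1983to89.T3OrbitAverage
open Summit.QuantumFields.YangMills.Theorems.OrganTangentFibreMeanTools
open Summit.QuantumFields.YangMills.Theorems.OrganTangentJensenGapTools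
open Summit.QuantumFields.YangMills.BalabanUVNodes.N09DomAltThresholdNull (isOpen_setOf_plaqSmall_SU)
open Literature.MathematicalPhysics.QuantumFieldTheory.Balaban1983to89.T3TiltDescent (descendTo measurable_descendTo)
open Literature.MathematicalPhysics.QuantumFieldTheory.Balaban1983to89.T3DescentFibreTower (descendTo_self)
open Summit.QuantumFields.YangMills.Theorems.FluctuationComparisonRegPrIntLOrganTangentAPackageDescendTo (absolutelyContinuous_map_descendTo)

/-- ★★ **THE m-STEP JENSEN GAP IS THE INTEGRATED TILTED m-STEP FIBRE VARIANCE OF THE SEED DISCREPANCY.**  O1ᵘ-H v2's frame at heights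
`j < K` (`j + 1 ≤ K`; `K` = the seed height `Ts`): top densities `r, r′` (measurable; positive and continuous on the top window `{PlaqSmall θ_K}`,
`0 < θ_K`), bottom densities `rj, rj′` (measurable; positive and continuous on `W = {PlaqSmall θ_j}`), the m-step SF-projected consistency identities
`rj·dU_j = (descendTo j K)_* (χ·r·dU_K)`, `rj′·dU_j = (descendTo j K)_* (χ·r′·dU_K)` in the frame's `withDensity` spelling (clause ⑦ iterated on `[j, K)`:
✓(L18) `…TowerCutIterate.towerCut_iterate`), a continuous cutoff `χ ≥ 0` supported in and positive on the MULTI-LEVEL WINDOW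
`MW_{j,K} = {U | ∀ n ∈ [j+1, K], PlaqSmall (24∕25·θ_n) (descendTo n K U)}` (the frame's multi-level-window weight `χ_{j,K}` is one such: ✓(L19));
a disintegration `σ` of `dU_K` along `descendTo j K` and a `W`-continuous `m` with `m V = (∫ χ h r′ dσ_V)∕(∫ χ r′ dσ_V)` for `dU_j`-a.e. `V ∈ W`
(`h = log r − log r′`, the SEED discrepancy; JENᵘ-H's `mfun` hypothesis shape); and the m-step (A)-package `(σ₀, λ; (A1-MW)(A2-MW)(A3-MW))` of
`descendTo j K` (✓(L16) `…APackageDescendTo.exists_height_regularSmallFieldDisintegration_descendTo`'s letters VERBATIM).  THEN for EVERY `V ∈ W`: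
(i) `t ↦ Var[h; P_V.tilted (t·h)]` is continuous, `P_V := (χ·r′)·λ_V`, and (ii) `log rj V − log rj′ V − m V = ∫₀¹ (1 − t)·Var[h; P_V.tilted (t·h)] dt` —
the m-step Jensen gap is the integrated variance of the seed discrepancy under the interpolated m-step small-field fibre law `∝ χ·r^t·r′^{1−t}·λ_V`.
PROOF = ✓`…OrganTangentJensenGapKnit.jensenGap_eq_integral_variance` (w3 g23) transposed from `descend F ℰp j` to `descendTo F ℰp j K`: the only new
inputs are ✓(L16) `absolutelyContinuous_map_descendTo` and `descendTo_self` (the top factor of `MW` puts `tsupport χ` inside the top window, where `h`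
is bounded on the closed `24∕25`-shell).  Four-point ∕ `HClauseSq` bounds then transfer with the factor `1∕2` by ✓`…JensenGapTools.abs_fourPoint_le_of_eq_integral`.
[cite: Balaban1987RG1, §2 p.264; Balaban1985Averaging, (10)-(13) p.19; Balaban1985UV3, (7) p.257] -/
theorem jensenGapMW_eq_integral_variance
    (F : T3Family) (γ b₀ p₀ : ℝ) (j K : ℕ) (hjK : j + 1 ≤ K) (hθ : 0 < θBal F.L γ b₀ p₀ K)
    (r r' : GaugeField (F.P K) 0 ↥(Matrix.specialUnitaryGroup (Fin 2) ℂ) → ℝ) (hrm : Measurable r) (hrm' : Measurable r')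
    (rj rj' : GaugeField (F.P j) 0 ↥(Matrix.specialUnitaryGroup (Fin 2) ℂ) → ℝ) (hrjm : Measurable rj) (hrjm' : Measurable rj')
    (hpos : ∀ U, PlaqSmall (θBal F.L γ b₀ p₀ K) U → 0 < r U ∧ 0 < r' U)
    (hr : ContinuousOn r {U | PlaqSmall (θBal F.L γ b₀ p₀ K) U})
    (hr' : ContinuousOn r' {U | PlaqSmall (θBal F.L γ b₀ p₀ K) U})
    (hrjpos : ∀ V, PlaqSmall (θBal F.L γ b₀ p₀ j) V → 0 < rj V ∧ 0 < rj' V)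
    (hrjc : ContinuousOn rj {V | PlaqSmall (θBal F.L γ b₀ p₀ j) V})
    (hrjc' : ContinuousOn rj' {V | PlaqSmall (θBal F.L γ b₀ p₀ j) V})
    (χ : GaugeField (F.P K) 0 ↥(Matrix.specialUnitaryGroup (Fin 2) ℂ) → ℝ) (hχc : Continuous χ) (hχ0 : ∀ U, 0 ≤ χ U)
    (hχsupp : ∀ U, χ U ≠ 0 → ∀ (n : ℕ) (hjn : j + 1 ≤ n) (hnK : n ≤ K), PlaqSmall (24 / 25 * θBal F.L γ b₀ p₀ n) (descendTo F ℰp n K hnK U))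
    (hχpos : ∀ U, (∀ (n : ℕ) (hjn : j + 1 ≤ n) (hnK : n ≤ K), PlaqSmall (24 / 25 * θBal F.L γ b₀ p₀ n) (descendTo F ℰp n K hnK U)) → 0 < χ U)
    (hcons : (((fieldMeasure (F.P K) 0 ↥(Matrix.specialUnitaryGroup (Fin 2) ℂ)).withDensity
        (fun U => ENNReal.ofReal (r U))).withDensity (fun U => ENNReal.ofReal (χ U))).map (descendTo F ℰp j K (Nat.le_of_succ_le hjK)) =
      (fieldMeasure (F.P j) 0 ↥(Matrix.specialUnitaryGroup (Fin 2) ℂ)).withDensity (fun V => ENNReal.ofReal (rj V)))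
    (hcons' : (((fieldMeasure (F.P K) 0 ↥(Matrix.specialUnitaryGroup (Fin 2) ℂ)).withDensity
        (fun U => ENNReal.ofReal (r' U))).withDensity (fun U => ENNReal.ofReal (χ U))).map (descendTo F ℰp j K (Nat.le_of_succ_le hjK)) =
      (fieldMeasure (F.P j) 0 ↥(Matrix.specialUnitaryGroup (Fin 2) ℂ)).withDensity (fun V => ENNReal.ofReal (rj' V)))
    (σ : Kernel (GaugeField (F.P j) 0 ↥(Matrix.specialUnitaryGroup (Fin 2) ℂ))
      (GaugeField (F.P K) 0 ↥(Matrix.specialUnitaryGroup (Fin 2) ℂ)))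
    (hσM : IsMarkovKernel σ)
    (hbind : (Measure.map (descendTo F ℰp j K (Nat.le_of_succ_le hjK)) (fieldMeasure (F.P K) 0 ↥(Matrix.specialUnitaryGroup (Fin 2) ℂ))).bind ⇑σ =
      fieldMeasure (F.P K) 0 ↥(Matrix.specialUnitaryGroup (Fin 2) ℂ))
    (hfib : ∀ᵐ V ∂(Measure.map (descendTo F ℰp j K (Nat.le_of_succ_le hjK)) (fieldMeasure (F.P K) 0 ↥(Matrix.specialUnitaryGroup (Fin 2) ℂ))),
      ∀ᵐ U ∂(σ V), descendTo F ℰp j K (Nat.le_of_succ_le hjK) U = V)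
    (m : GaugeField (F.P j) 0 ↥(Matrix.specialUnitaryGroup (Fin 2) ℂ) → ℝ)
    (hmc : ContinuousOn m {V | PlaqSmall (θBal F.L γ b₀ p₀ j) V})
    (hm : ∀ᵐ V ∂(fieldMeasure (F.P j) 0 ↥(Matrix.specialUnitaryGroup (Fin 2) ℂ)), PlaqSmall (θBal F.L γ b₀ p₀ j) V →
      Integrable (fun U => χ U * (Real.log (r U) - Real.log (r' U)) * r' U) (σ V) ∧
        m V = (∫ U, χ U * (Real.log (r U) - Real.log (r' U)) * r' U ∂(σ V)) / (∫ U, χ U * r' U ∂(σ V)))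
    (σ₀ : Kernel (GaugeField (F.P j) 0 ↥(Matrix.specialUnitaryGroup (Fin 2) ℂ))
      (GaugeField (F.P K) 0 ↥(Matrix.specialUnitaryGroup (Fin 2) ℂ)))
    (hσ₀M : IsMarkovKernel σ₀)
    (hbind₀ : (Measure.map (descendTo F ℰp j K (Nat.le_of_succ_le hjK)) (fieldMeasure (F.P K) 0 ↥(Matrix.specialUnitaryGroup (Fin 2) ℂ))).bind ⇑σ₀ =
      fieldMeasure (F.P K) 0 ↥(Matrix.specialUnitaryGroup (Fin 2) ℂ))
    (hfib₀ : ∀ᵐ V ∂(Measure.map (descendTo F ℰp j K (Nat.le_of_succ_le hjK)) (fieldMeasure (F.P K) 0 ↥(Matrix.specialUnitaryGroup (Fin 2) ℂ))),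
      ∀ᵐ U ∂(σ₀ V), descendTo F ℰp j K (Nat.le_of_succ_le hjK) U = V)
    (lam : GaugeField (F.P j) 0 ↥(Matrix.specialUnitaryGroup (Fin 2) ℂ) →
      Measure (GaugeField (F.P K) 0 ↥(Matrix.specialUnitaryGroup (Fin 2) ℂ)))
    (hlam : ∀ V, IsFiniteMeasure (lam V))
    (hA1 : ∀ f : GaugeField (F.P K) 0 ↥(Matrix.specialUnitaryGroup (Fin 2) ℂ) → ℝ, Continuous f →
      (∀ U, f U ≠ 0 → ∀ (n : ℕ) (hjn : j + 1 ≤ n) (hnK : n ≤ K), PlaqSmall (24 / 25 * θBal F.L γ b₀ p₀ n) (descendTo F ℰp n K hnK U)) →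
      ContinuousOn (fun V => ∫ U, f U ∂(lam V)) {V | PlaqSmall (θBal F.L γ b₀ p₀ j) V})
    (hA2 : ∀ V, PlaqSmall (θBal F.L γ b₀ p₀ j) V → 0 < lam V {U | ∀ (n : ℕ) (hjn : j + 1 ≤ n) (hnK : n ≤ K), PlaqSmall (24 / 25 * θBal F.L γ b₀ p₀ n) (descendTo F ℰp n K hnK U)})
    (hA3 : ∃ c : GaugeField (F.P j) 0 ↥(Matrix.specialUnitaryGroup (Fin 2) ℂ) → ℝ,
      ∀ f : GaugeField (F.P K) 0 ↥(Matrix.specialUnitaryGroup (Fin 2) ℂ) → ℝ, Continuous f →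
        (∀ U, ¬ (∀ (n : ℕ) (hjn : j + 1 ≤ n) (hnK : n ≤ K), PlaqSmall (24 / 25 * θBal F.L γ b₀ p₀ n) (descendTo F ℰp n K hnK U)) → f U = 0) →
        ∀ᵐ V ∂(Measure.map (descendTo F ℰp j K (Nat.le_of_succ_le hjK)) (fieldMeasure (F.P K) 0 ↥(Matrix.specialUnitaryGroup (Fin 2) ℂ))),
          PlaqSmall (θBal F.L γ b₀ p₀ j) V → 0 < c V ∧ ∫ U, f U ∂(σ₀ V) = c V * ∫ U, f U ∂(lam V)) :
    ∀ V, PlaqSmall (θBal F.L γ b₀ p₀ j) V →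
      Continuous (fun t : ℝ => variance (fun U => Real.log (r U) - Real.log (r' U))
          (((lam V).withDensity (fun U => ENNReal.ofReal (χ U * r' U))).tilted
            (fun U => t * (Real.log (r U) - Real.log (r' U))))) ∧
      Real.log (rj V) - Real.log (rj' V) - m V =
        ∫ t in (0 : ℝ)..1, (1 - t) *
          variance (fun U => Real.log (r U) - Real.log (r' U))
            (((lam V).withDensity (fun U => ENNReal.ofReal (χ U * r' U))).tilted
              (fun U => t * (Real.log (r U) - Real.log (r' U)))) := by
  haveI := hσM
  haveI := hσ₀M
  haveI : BorelSpace (GaugeField (F.P K) 0 ↥(Matrix.specialUnitaryGroup (Fin 2) ℂ)) :=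
    T3OrbitAverage.instBorelSpaceGaugeField
  haveI : BorelSpace (GaugeField (F.P j) 0 ↥(Matrix.specialUnitaryGroup (Fin 2) ℂ)) :=
    T3OrbitAverage.instBorelSpaceGaugeField
  -- abbreviations
  set θ' : ℝ := θBal F.L γ b₀ p₀ K with hθ'
  set θj : ℝ := θBal F.L γ b₀ p₀ j with hθj
  set Hf : Measure (GaugeField (F.P K) 0 ↥(Matrix.specialUnitaryGroup (Fin 2) ℂ)) :=
    fieldMeasure (F.P K) 0 ↥(Matrix.specialUnitaryGroup (Fin 2) ℂ) with hHf
  set Hc : Measure (GaugeField (F.P j) 0 ↥(Matrix.specialUnitaryGroup (Fin 2) ℂ)) :=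
    fieldMeasure (F.P j) 0 ↥(Matrix.specialUnitaryGroup (Fin 2) ℂ) with hHc
  haveI : IsProbabilityMeasure Hf := Missing.isProbabilityMeasure_fieldMeasure _ _
  haveI : IsProbabilityMeasure Hc := Missing.isProbabilityMeasure_fieldMeasure _ _
  haveI : Hc.IsOpenPosMeasure := B12ContinuousTransportInvariance.isOpenPosMeasure_fieldMeasure_SU 2 (F.P j) 0
  haveI : Nonempty (GaugeField (F.P K) 0 ↥(Matrix.specialUnitaryGroup (Fin 2) ℂ)) := ⟨fun _ => 1⟩
  have hd : Measurable (descendTo F ℰp j K (Nat.le_of_succ_le hjK) :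
      GaugeField (F.P K) 0 ↥(Matrix.specialUnitaryGroup (Fin 2) ℂ) →
        GaugeField (F.P j) 0 ↥(Matrix.specialUnitaryGroup (Fin 2) ℂ)) :=
    measurable_descendTo F ℰp measurableE_ℰp (Nat.le_of_succ_le hjK)
  -- the windows
  set O : Set (GaugeField (F.P K) 0 ↥(Matrix.specialUnitaryGroup (Fin 2) ℂ)) := {U | PlaqSmall θ' U} with hO
  -- the multi-level window `MW_{j,K}` (the cut of record, ✓(L16)) and its top shell
  set O₃ : Set (GaugeField (F.P K) 0 ↥(Matrix.specialUnitaryGroup (Fin 2) ℂ)) :=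
    {U | ∀ (n : ℕ) (hjn : j + 1 ≤ n) (hnK : n ≤ K), PlaqSmall (24 / 25 * θBal F.L γ b₀ p₀ n) (descendTo F ℰp n K hnK U)} with hO₃
  have hcθ : 24 / 25 * θ' < θ' := by rw [hθ']; linarith
  have htop : ∀ U, U ∈ O₃ → PlaqSmall (24 / 25 * θ') U := by
    intro U hU
    have h := hU K hjK le_rfl
    rwa [descendTo_self] at h
  have hχtop : ∀ U, χ U ≠ 0 → PlaqSmall (24 / 25 * θ') U := fun U hU => htop U (hχsupp U hU)
  set W : Set (GaugeField (F.P j) 0 ↥(Matrix.specialUnitaryGroup (Fin 2) ℂ)) := {V | PlaqSmall θj V} with hW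
  have hOopen : IsOpen O := isOpen_setOf_plaqSmall_SU 2 (F.P K) 0 θ'
  have hWopen : IsOpen W := isOpen_setOf_plaqSmall_SU 2 (F.P j) 0 θj
  have hWm : MeasurableSet W := hWopen.measurableSet
  have hχts : tsupport χ ⊆ O := tsupport_subset_plaqSmall hcθ hχtop
  have hO₃O : O₃ ⊆ O := fun U hU p => (htop U hU p).trans hcθ
  have hχm : Measurable χ := hχc.measurable
  -- the discrepancy and the three localised integrands, globally continuous
  set hfun : GaugeField (F.P K) 0 ↥(Matrix.specialUnitaryGroup (Fin 2) ℂ) → ℝ :=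
    fun U => Real.log (r U) - Real.log (r' U) with hhfun
  have hhc : ContinuousOn hfun O :=
    (hr.log fun U hU => (hpos U hU).1.ne').sub (hr'.log fun U hU => (hpos U hU).2.ne')
  have hhm : Measurable hfun := (Real.measurable_log.comp hrm).sub (Real.measurable_log.comp hrm')
  set f₁ : GaugeField (F.P K) 0 ↥(Matrix.specialUnitaryGroup (Fin 2) ℂ) → ℝ := fun U => χ U * (hfun U * r' U) with hf₁
  set f₂ : GaugeField (F.P K) 0 ↥(Matrix.specialUnitaryGroup (Fin 2) ℂ) → ℝ := fun U => χ U * r' U with hf₂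
  set f₃ : GaugeField (F.P K) 0 ↥(Matrix.specialUnitaryGroup (Fin 2) ℂ) → ℝ := fun U => χ U * r U with hf₃
  have hf₁c : Continuous f₁ := continuous_mul_of_tsupport_subset hOopen hχc hχts (hhc.mul hr')
  have hf₂c : Continuous f₂ := continuous_mul_of_tsupport_subset hOopen hχc hχts hr'
  have hf₃c : Continuous f₃ := continuous_mul_of_tsupport_subset hOopen hχc hχts hr
  have hf₁eq : (fun U => χ U * (Real.log (r U) - Real.log (r' U)) * r' U) = f₁ := by
    funext U; simp only [hf₁, hhfun]; ring
  have hf₁supp : ∀ U, f₁ U ≠ 0 → U ∈ O₃ := fun U hU => hχsupp U (left_ne_zero_of_mul hU)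
  have hf₂supp : ∀ U, f₂ U ≠ 0 → U ∈ O₃ := fun U hU => hχsupp U (left_ne_zero_of_mul hU)
  have hf₃supp : ∀ U, f₃ U ≠ 0 → U ∈ O₃ := fun U hU => hχsupp U (left_ne_zero_of_mul hU)
  have hf₁zero : ∀ U, U ∉ O₃ → f₁ U = 0 := fun U hU => by by_contra h; exact hU (hf₁supp U h)
  have hf₂zero : ∀ U, U ∉ O₃ → f₂ U = 0 := fun U hU => by by_contra h; exact hU (hf₂supp U h)
  have hf₃zero : ∀ U, U ∉ O₃ → f₃ U = 0 := fun U hU => by by_contra h; exact hU (hf₃supp U h)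
  have hf₂nn : ∀ U, 0 ≤ f₂ U := by
    intro U
    by_cases hU : χ U = 0
    · simp only [hf₂, hU, zero_mul, le_refl]
    · exact mul_nonneg (hχ0 U) (hpos U (hO₃O (hχsupp U hU))).2.le
  have hf₃nn : ∀ U, 0 ≤ f₃ U := by
    intro U
    by_cases hU : χ U = 0
    · simp only [hf₃, hU, zero_mul, le_refl]
    · exact mul_nonneg (hχ0 U) (hpos U (hO₃O (hχsupp U hU))).1.le
  have hf₂O₃ : ∀ U, U ∈ O₃ → f₂ U ≠ 0 := fun U hU => mul_ne_zero (hχpos U hU).ne' (hpos U (hO₃O hU)).2.ne'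
  have hf₃O₃ : ∀ U, U ∈ O₃ → f₃ U ≠ 0 := fun U hU => mul_ne_zero (hχpos U hU).ne' (hpos U (hO₃O hU)).1.ne'
  -- on the support of `χ`: `r′·e^{h} = r`, so `f₂·e^{h} = f₃`; and `f₂·h = f₁`
  have hf₂exp : ∀ U, f₂ U * Real.exp (hfun U) = f₃ U := by
    intro U
    by_cases hU : χ U = 0
    · simp only [hf₂, hf₃, hU, zero_mul]
    · have hUO : U ∈ O := hO₃O (hχsupp U hU)
      have h1 : Real.exp (hfun U) = r U / r' U := by
        simp only [hhfun]; rw [Real.exp_sub, Real.exp_log (hpos U hUO).1, Real.exp_log (hpos U hUO).2]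
      simp only [hf₂, hf₃]; rw [h1, mul_assoc, mul_div_cancel₀ _ (hpos U hUO).2.ne']
  -- the λ-integrals: numerator, denominator, unprimed numerator; continuity and positivity on `W`
  set num : GaugeField (F.P j) 0 ↥(Matrix.specialUnitaryGroup (Fin 2) ℂ) → ℝ := fun V => ∫ U, f₁ U ∂(lam V) with hnum
  set den : GaugeField (F.P j) 0 ↥(Matrix.specialUnitaryGroup (Fin 2) ℂ) → ℝ := fun V => ∫ U, f₂ U ∂(lam V) with hden
  set nup : GaugeField (F.P j) 0 ↥(Matrix.specialUnitaryGroup (Fin 2) ℂ) → ℝ := fun V => ∫ U, f₃ U ∂(lam V) with hnup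
  have hnumc : ContinuousOn num W := hA1 f₁ hf₁c hf₁supp
  have hdenc : ContinuousOn den W := hA1 f₂ hf₂c hf₂supp
  have hnupc : ContinuousOn nup W := hA1 f₃ hf₃c hf₃supp
  have hpos_of : ∀ {f : GaugeField (F.P K) 0 ↥(Matrix.specialUnitaryGroup (Fin 2) ℂ) → ℝ}, Continuous f →
      (∀ U, 0 ≤ f U) → (∀ U, U ∈ O₃ → f U ≠ 0) → ∀ V, V ∈ W → 0 < ∫ U, f U ∂(lam V) := by
    intro f hfc hfnn hfO₃ V hV
    haveI := hlam V
    have hint : Integrable f (lam V) := integrable_of_continuous_compact hfc (lam V)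
    refine (integral_pos_iff_support_of_nonneg_ae (Eventually.of_forall hfnn) hint).mpr ?_
    exact (hA2 V hV).trans_le (measure_mono fun U hU => Function.mem_support.mpr (hfO₃ U hU))
  have hdenpos : ∀ V, V ∈ W → 0 < den V := hpos_of hf₂c hf₂nn hf₂O₃
  have hnuppos : ∀ V, V ∈ W → 0 < nup V := hpos_of hf₃c hf₃nn hf₃O₃
  obtain ⟨c, hc⟩ := hA3
  ------------------------------------------------------------------
  -- STEP A: `rj·den = rj′·nup` on `W` (disintegration computes the push-forward densities; a.e. ⇒ everywhere)
  ------------------------------------------------------------------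
  set ν : Measure (GaugeField (F.P j) 0 ↥(Matrix.specialUnitaryGroup (Fin 2) ℂ)) := Hf.map (descendTo F ℰp j K (Nat.le_of_succ_le hjK)) with hν
  -- the frame's double density is the single density `χ·r` (resp. `χ·r′`)
  have hdd : ∀ (ρ : GaugeField (F.P K) 0 ↥(Matrix.specialUnitaryGroup (Fin 2) ℂ) → ℝ), Measurable ρ →
      (∀ U, χ U ≠ 0 → 0 ≤ ρ U) →
      (Hf.withDensity (fun U => ENNReal.ofReal (ρ U))).withDensity (fun U => ENNReal.ofReal (χ U)) =
        Hf.withDensity (fun U => ENNReal.ofReal (χ U * ρ U)) := by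
    intro ρ hρm hρnn
    rw [← withDensity_mul _ hρm.ennreal_ofReal hχm.ennreal_ofReal]
    refine withDensity_congr_ae (Eventually.of_forall fun U => ?_)
    show (fun U => ENNReal.ofReal (ρ U)) U * (fun U => ENNReal.ofReal (χ U)) U = ENNReal.ofReal (χ U * ρ U)
    simp only
    by_cases hU : χ U = 0
    · simp [hU]
    · rw [← ENNReal.ofReal_mul (hρnn U hU), mul_comm]
  have hr_nn : ∀ U, χ U ≠ 0 → 0 ≤ r U := fun U hU => (hpos U (hO₃O (hχsupp U hU))).1.le
  have hr'_nn : ∀ U, χ U ≠ 0 → 0 ≤ r' U := fun U hU => (hpos U (hO₃O (hχsupp U hU))).2.le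
  rw [hdd r hrm hr_nn] at hcons
  rw [hdd r' hrm' hr'_nn] at hcons'
  -- disintegration: `(f·Hf).map descend = (V ↦ ∫⁻ f dσ₀_V)·ν`
  have hdis3 := map_withDensity_eq_withDensity_lintegral Hf hd σ₀ hbind₀ hfib₀
    hf₃c.measurable.ennreal_ofReal
  have hdis2 := map_withDensity_eq_withDensity_lintegral Hf hd σ₀ hbind₀ hfib₀
    hf₂c.measurable.ennreal_ofReal
  -- Radon–Nikodym: `ν = Z·Hc`
  have hνac : ν ≪ Hc := absolutelyContinuous_map_descendTo F j K (Nat.le_of_succ_le hjK)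
  set Z : GaugeField (F.P j) 0 ↥(Matrix.specialUnitaryGroup (Fin 2) ℂ) → ℝ≥0∞ := ν.rnDeriv Hc with hZ
  have hZm : Measurable Z := Measure.measurable_rnDeriv ν Hc
  have hνZ : Hc.withDensity Z = ν := Measure.withDensity_rnDeriv_eq ν Hc hνac
  set G₃ : GaugeField (F.P j) 0 ↥(Matrix.specialUnitaryGroup (Fin 2) ℂ) → ℝ≥0∞ :=
    fun V => ∫⁻ U, ENNReal.ofReal (f₃ U) ∂(σ₀ V) with hG₃
  set G₂ : GaugeField (F.P j) 0 ↥(Matrix.specialUnitaryGroup (Fin 2) ℂ) → ℝ≥0∞ :=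
    fun V => ∫⁻ U, ENNReal.ofReal (f₂ U) ∂(σ₀ V) with hG₂
  have hG₃m : Measurable G₃ := hf₃c.measurable.ennreal_ofReal.lintegral_kernel
  have hG₂m : Measurable G₂ := hf₂c.measurable.ennreal_ofReal.lintegral_kernel
  have hae3 : (fun V => ENNReal.ofReal (rj V)) =ᵐ[Hc] Z * G₃ := by
    rw [← withDensity_eq_iff_of_sigmaFinite hrjm.ennreal_ofReal.aemeasurable (hZm.mul hG₃m).aemeasurable,
      withDensity_mul _ hZm hG₃m, hνZ, ← hdis3, hcons]
  have hae2 : (fun V => ENNReal.ofReal (rj' V)) =ᵐ[Hc] Z * G₂ := by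
    rw [← withDensity_eq_iff_of_sigmaFinite hrjm'.ennreal_ofReal.aemeasurable (hZm.mul hG₂m).aemeasurable,
      withDensity_mul _ hZm hG₂m, hνZ, ← hdis2, hcons']
  -- (A3) on `f₃`, `f₂`, transferred from `ν`-a.e. to `Hc`-a.e. on `W` through `hcons'` (`rj′ > 0` on `W`)
  have hWne' : ∀ V ∈ W, ENNReal.ofReal (rj' V) ≠ 0 := fun V hV => (ENNReal.ofReal_pos.mpr (hrjpos V hV).2).ne'
  have hρX' : AEMeasurable (fun V => ENNReal.ofReal (rj' V)) Hc := hrjm'.ennreal_ofReal.aemeasurable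
  have hA3W : ∀ᵐ V ∂Hc, V ∈ W → (0 < c V ∧ ∫ U, f₃ U ∂(σ₀ V) = c V * nup V ∧ ∫ U, f₂ U ∂(σ₀ V) = c V * den V) := by
    have h : ∀ᵐ V ∂ν, V ∈ W → (0 < c V ∧ ∫ U, f₃ U ∂(σ₀ V) = c V * nup V ∧ ∫ U, f₂ U ∂(σ₀ V) = c V * den V) := by
      filter_upwards [hc f₃ hf₃c hf₃zero, hc f₂ hf₂c hf₂zero] with V h3 h2 hV
      exact ⟨(h3 hV).1, (h3 hV).2, (h2 hV).2⟩
    have h' := ae_on_of_ae_map_of_withDensity_eq Hf hd Hc (fun U => ENNReal.ofReal (f₂ U)) hρX' hcons' hWne' h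
    filter_upwards [h'] with V hV hVW
    exact hV hVW hVW
  -- lintegral of a nonneg continuous function on a probability fibre = ofReal of its integral
  have hGof : ∀ {f : GaugeField (F.P K) 0 ↥(Matrix.specialUnitaryGroup (Fin 2) ℂ) → ℝ}, Continuous f → (∀ U, 0 ≤ f U) →
      ∀ V, ∫⁻ U, ENNReal.ofReal (f U) ∂(σ₀ V) = ENNReal.ofReal (∫ U, f U ∂(σ₀ V)) := by
    intro f hfc hfnn V
    rw [ofReal_integral_eq_lintegral_ofReal (integrable_of_continuous_compact hfc (σ₀ V)) (Eventually.of_forall hfnn)]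
  have hprod : ∀ᵐ V ∂Hc, V ∈ W → rj V * den V = rj' V * nup V := by
    filter_upwards [hae3, hae2, hA3W] with V h3 h2 hAV hV
    obtain ⟨hc0, e3, e2⟩ := hAV hV
    have e3' : G₃ V = ENNReal.ofReal (c V * nup V) := by rw [hG₃]; simp only; rw [hGof hf₃c hf₃nn, e3]
    have e2' : G₂ V = ENNReal.ofReal (c V * den V) := by rw [hG₂]; simp only; rw [hGof hf₂c hf₂nn, e2]
    have hdenV : 0 ≤ den V := (hdenpos V hV).le
    have hnupV : 0 ≤ nup V := (hnuppos V hV).le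
    have hk : ENNReal.ofReal (rj V * den V) = ENNReal.ofReal (rj' V * nup V) := by
      rw [ENNReal.ofReal_mul (hrjpos V hV).1.le, ENNReal.ofReal_mul (hrjpos V hV).2.le]
      rw [show ENNReal.ofReal (rj V) = (Z * G₃) V from h3, show ENNReal.ofReal (rj' V) = (Z * G₂) V from h2]
      simp only [Pi.mul_apply]
      rw [e3', e2', mul_assoc, mul_assoc, ← ENNReal.ofReal_mul (mul_nonneg hc0.le hnupV),
        ← ENNReal.ofReal_mul (mul_nonneg hc0.le hdenV)]
      congr 2; ring
    exact (ENNReal.ofReal_eq_ofReal_iff (mul_nonneg (hrjpos V hV).1.le hdenV) (mul_nonneg (hrjpos V hV).2.le hnupV)).mp hk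
  have hprodW : EqOn (fun V => rj V * den V) (fun V => rj' V * nup V) W :=
    Measure.eqOn_open_of_ae_eq ((ae_restrict_iff' hWm).mpr hprod) hWopen (hrjc.mul hdenc) (hrjc'.mul hnupc)
  ------------------------------------------------------------------
  -- STEP B: `m = num∕den` on `W` (uniqueness of the disintegration + (A3) + transfer; a.e. ⇒ everywhere)
  ------------------------------------------------------------------
  have huniq : ∀ᵐ V ∂ν, σ V = σ₀ V := ae_eq_of_bind_of_bind Hf hd σ σ₀ hbind hfib hbind₀ hfib₀
  have hkey : ∀ᵐ V ∂ν, V ∈ W →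
      (∫ U, χ U * (Real.log (r U) - Real.log (r' U)) * r' U ∂(σ V)) / (∫ U, χ U * r' U ∂(σ V)) = num V / den V := by
    filter_upwards [huniq, hc f₁ hf₁c hf₁zero, hc f₂ hf₂c hf₂zero] with V hVσ hV1 hV2 hVW
    obtain ⟨hc0, hres1⟩ := hV1 hVW
    obtain ⟨-, hres2⟩ := hV2 hVW
    rw [hf₁eq, show (fun U => χ U * r' U) = f₂ from rfl, hVσ, hres1, hres2, mul_div_mul_left _ _ hc0.ne']
  have hmae : ∀ᵐ V ∂Hc, V ∈ W → m V = num V / den V := by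
    have h1 := ae_on_of_ae_map_of_withDensity_eq Hf hd Hc (fun U => ENNReal.ofReal (f₂ U)) hρX' hcons' hWne' hkey
    filter_upwards [h1, hm] with V hV hmV hVW
    rw [(hmV hVW).2, hV hVW hVW]
  have hmW : EqOn m (fun V => num V / den V) W :=
    Measure.eqOn_open_of_ae_eq ((ae_restrict_iff' hWm).mpr hmae) hWopen hmc (hnumc.div hdenc fun V hV => (hdenpos V hV).ne')
  ------------------------------------------------------------------
  -- STEP C: the cumulant generating function of `h` under `P_V = (χ·r′)·λ_V`
  ------------------------------------------------------------------
  intro V hV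
  haveI := hlam V
  set P : Measure (GaugeField (F.P K) 0 ↥(Matrix.specialUnitaryGroup (Fin 2) ℂ)) :=
    (lam V).withDensity (fun U => ENNReal.ofReal (χ U * r' U)) with hP
  have hPf₂ : P = (lam V).withDensity (fun U => ENNReal.ofReal (f₂ U)) := rfl
  have hf₂m : Measurable fun U => ENNReal.ofReal (f₂ U) := hf₂c.measurable.ennreal_ofReal
  have hf₂i : Integrable f₂ (lam V) := integrable_of_continuous_compact hf₂c (lam V)
  haveI : IsFiniteMeasure P := isFiniteMeasure_withDensity_ofReal hf₂i.2
  -- integrals against `P` are `f₂`-weighted λ-integrals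
  have hPint : ∀ g : GaugeField (F.P K) 0 ↥(Matrix.specialUnitaryGroup (Fin 2) ℂ) → ℝ,
      ∫ U, g U ∂P = ∫ U, f₂ U * g U ∂(lam V) := by
    intro g
    rw [hPf₂, integral_withDensity_eq_integral_toReal_smul hf₂m (Eventually.of_forall fun _ => ENNReal.ofReal_lt_top)]
    refine integral_congr_ae (Eventually.of_forall fun U => ?_)
    simp only [smul_eq_mul, ENNReal.toReal_ofReal (hf₂nn U)]
  have hPuniv : P.real Set.univ = den V := by
    rw [measureReal_def, hPf₂, withDensity_apply _ MeasurableSet.univ, Measure.restrict_univ,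
      ← ofReal_integral_eq_lintegral_ofReal hf₂i (Eventually.of_forall hf₂nn), ENNReal.toReal_ofReal (hdenpos V hV).le]
  haveI : NeZero P := ⟨fun h0 => by
    have : P.real Set.univ = 0 := by rw [h0]; simp
    rw [hPuniv] at this; exact (hdenpos V hV).ne' this⟩
  -- `|h| ≤ B` on the support of `χ` (compact shell inside the open fine window), hence `P`-a.e.
  obtain ⟨B, hB⟩ : ∃ B, ∀ U ∈ {U : GaugeField (F.P K) 0 ↥(Matrix.specialUnitaryGroup (Fin 2) ℂ) |
      ∀ p, dist1 (GaugeField.plaqHol U p) ≤ 24 / 25 * θ'}, |hfun U| ≤ B := by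
    have hK : IsCompact {U : GaugeField (F.P K) 0 ↥(Matrix.specialUnitaryGroup (Fin 2) ℂ) |
        ∀ p, dist1 (GaugeField.plaqHol U p) ≤ 24 / 25 * θ'} := (isClosed_setOf_dist1_le (24 / 25 * θ')).isCompact
    have hKO : {U : GaugeField (F.P K) 0 ↥(Matrix.specialUnitaryGroup (Fin 2) ℂ) |
        ∀ p, dist1 (GaugeField.plaqHol U p) ≤ 24 / 25 * θ'} ⊆ O := fun U hU p => (hU p).trans_lt hcθ
    obtain ⟨B, hB⟩ := hK.exists_bound_of_continuousOn (hhc.mono hKO)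
    exact ⟨B, fun U hU => by simpa [Real.norm_eq_abs] using hB U hU⟩
  have hBae : ∀ᵐ U ∂P, |hfun U| ≤ B := by
    rw [hPf₂, ae_withDensity_iff hf₂m]
    refine Eventually.of_forall fun U hU => hB U fun p => ?_
    have hχU : χ U ≠ 0 := fun h0 => hU (by simp [hf₂, h0])
    exact (hχtop U hχU p).le
  have hhP : AEMeasurable hfun P := hhm.aemeasurable
  have hint0 : (0 : ℝ) ∈ interior (integrableExpSet hfun P) :=
    B10Eq24Cumulant.mem_interior_integrableExpSet_of_abs_le hhP hBae 0
  -- `f(1) = log nup`, `f(0) = log den`, `f′(0) = num∕den`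
  have hcgf1 : cgf hfun P 1 = Real.log (nup V) := by
    rw [B10Eq24Cumulant.cgf_one_eq, hPint]
    show Real.log _ = Real.log (∫ U, f₃ U ∂(lam V))
    congr 1
    exact integral_congr_ae (Eventually.of_forall hf₂exp)
  have hcgf0 : cgf hfun P 0 = Real.log (den V) := by rw [cgf_zero', hPuniv]
  have hdcgf : deriv (cgf hfun P) 0 = num V / den V := by
    rw [deriv_cgf_zero hint0, hPuniv, hPint]
    congr 1
    exact integral_congr_ae (Eventually.of_forall fun U => by simp only [hf₁]; ring)
  -- assemble: q = f(1) − f(0) − f′(0) = ∫₀¹ (1−t) f″(t) dt, and f″(t) = Var[h; P.tilted (t·h)]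
  have hq : Real.log (rj V) - Real.log (rj' V) - m V = cgf hfun P 1 - cgf hfun P 0 - deriv (cgf hfun P) 0 := by
    rw [hcgf1, hcgf0, hdcgf, hmW hV]
    have hk : rj V * den V = rj' V * nup V := hprodW hV
    have h1 : Real.log (rj V) + Real.log (den V) = Real.log (rj' V) + Real.log (nup V) := by
      rw [← Real.log_mul (hrjpos V hV).1.ne' (hdenpos V hV).ne', ← Real.log_mul (hrjpos V hV).2.ne' (hnuppos V hV).ne', hk]
    linarith
  refine ⟨continuous_variance_tilted_of_abs_le hhP hBae, ?_⟩
  rw [hq]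
  exact cgf_one_sub_cgf_zero_sub_deriv_eq_integral_variance hhP hBae

end Summit.QuantumFields.YangMills.Theorems.FluctuationComparisonRegPrIntLOrganTangentJensenGapKnitMW

end
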